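import Summits.ResolutionOfSingularities.ResolutionOfSingularities.Theorems.FrobeniusLadderFInjectiveMacaulayficationFedderEtaleAscent
import Summits.ResolutionOfSingularities.ResolutionOfSingularities.Theorems.FrobeniusLadderFInjectiveMacaulayficationStandardEtaleLocal
import Mathlib.RingTheory.Unramified.LocalRing
import Mathlib.RingTheory.Flat.Stability
import HarnessLib

/-!
# (RF) FINITE SEPARABLE BASE CHANGE IS ÉTALE AT EVERY PRIME — hence the crux's stalk clause of a hypersurface germ neither appears nor disappears when the ground field is enlarged by a
# finite separable extension (the ASCENT half of GAP-2 «residue field ≠ k», parked since ✓p694038 `FullClDescent`, for hypersurface beds)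
# (crux `FInjectiveMacaulayfication` stmt-ResolutionOfSingularities-15315, chain w45a; res-L1-w45a-plan-1 ACK l.86083 priority (2) «★ (RF) the residue-field ascent for hypersurface germs at closed
# points with separable residue field … reusable by (r2)»; seat res-L1-w45a-stub-1 g15)

[OURS · L1 W4.5a] Support file (`--supports stmt-ResolutionOfSingularities-15315 --as helper`); theorems only; pure commutative algebra on top of Mathlib's unramified API. Nothing of the crux is
proved; no census row is asserted. AI-written (AI review is weaker than expert review).

THE FACTS. `k ⊆ K` a FINITE SEPARABLE field extension, `S` any `k`-algebra, `S_K := S ⊗_k K`, `Q ⊂ S_K` a prime over `q ⊂ S`. (1) `K/k` is formally unramified (Mathlib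
`Algebra.FormallyUnramified.of_isSeparable`), hence so is `S → S_K` (`base_change`) and its localisations; with `S_K` essentially of finite type over `S`, Mathlib's
`Algebra.isUnramifiedAt_iff_map_eq` gives `q·(S_K)_Q = Q·(S_K)_Q`; (2) `S_K` is flat over `S`, so `S_q → (S_K)_Q` is FAITHFULLY FLAT (✓p703993 `faithfullyFlat_atPrime`). Hence (3) for regular
`S_q`, `(S_K)_Q` (e.g. polynomial rings) and `f ∈ q`, `f ≠ 0`: the crux's stalk clause holds for `S_q/(f)` IFF it holds for `(S_K)_Q/(f)` (✓p703692 `clause_hypersurface_iff_of_faithfullyFlat`).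
NO hypothesis on the residue field `κ(q)` is needed in this form (for `K/k` separable the fibre `K ⊗_k κ(q)` is reduced regardless); the closed points REACHED as `K`-rational points are
those with `κ(q)` separable over `k` (all of them when `k` is perfect) — the «`K = k̄`, `κ(q)/k` separable» variant has the same conclusion and is not typed here.
* §1 ★ `map_maximalIdeal_eq_of_separable_baseChange`, ★ `faithfullyFlat_of_separable_baseChange`; §2 ★★ `clause_hypersurface_iff_separable_baseChange`, `fullCl_hypersurface_iff_separable_baseChange`
  (with the two `IsDomain` facts supplied).
[cite: StacksProject, Tag 00UW, Tag 02FM; Fedder1983, Thm. 1.12; Matsumura1987, Thm. 7.5]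
-/

set_option linter.dupNamespace false

noncomputable section

open scoped TensorProduct

namespace Summit.ResolutionOfSingularities.ResolutionOfSingularities.Theorems.FInjectiveMacaulayfication.SeparableBaseChangeAscent

open IsLocalRing Literature.RingTheory.TightClosure
open Summit.ResolutionOfSingularities.ResolutionOfSingularities.Theorems.FInjectiveMacaulayfication SliceableCentre

variable (k K S : Type) [Field k] [Field K] [Algebra k K] [CommRing S] [Algebra k S]

/-! ## §1 ★ Finite separable base change is étale at every prime -/

/-- ★ **UNRAMIFIED**: for `K/k` finite separable and `Q ⊂ S ⊗_k K` over `q ⊂ S`: `𝔪_{S_q}·(S_K)_Q = 𝔪_{(S_K)_Q}`. [Mathlib's unramified API assembled; cite: StacksProject, Tag 02FM] -/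
theorem map_maximalIdeal_eq_of_separable_baseChange [Algebra.IsSeparable k K] [FiniteDimensional k K]
    (Q : Ideal (S ⊗[k] K)) [Q.IsPrime] (q : Ideal S) [q.IsPrime] [Q.LiesOver q] :
    letI := Localization.AtPrime.algebraOfLiesOver q Q
    (maximalIdeal (Localization.AtPrime q)).map (algebraMap (Localization.AtPrime q) (Localization.AtPrime Q)) = maximalIdeal (Localization.AtPrime Q) := by
  letI := Localization.AtPrime.algebraOfLiesOver q Q
  haveI : Algebra.FormallyUnramified k K := Algebra.FormallyUnramified.of_isSeparable k K
  haveI : Algebra.FormallyUnramified S (S ⊗[k] K) := inferInstance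
  haveI : Algebra.IsUnramifiedAt S Q := inferInstance
  haveI : Algebra.EssFiniteType S (S ⊗[k] K) := inferInstance
  have h := ((Algebra.isUnramifiedAt_iff_map_eq S q Q).mp inferInstance).2
  rw [← Localization.AtPrime.map_eq_maximalIdeal (I := q), Ideal.map_map, ← IsScalarTower.algebraMap_eq]
  exact h

/-- ★ **FAITHFULLY FLAT**: `S_q → (S ⊗_k K)_Q` is faithfully flat (any field extension `K/k`). [✓p703993 `faithfullyFlat_atPrime`; cite: Matsumura1987, Thm. 7.5] -/
theorem faithfullyFlat_of_baseChange (Q : Ideal (S ⊗[k] K)) [Q.IsPrime] (q : Ideal S) [q.IsPrime] [Q.LiesOver q] :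
    letI := Localization.AtPrime.algebraOfLiesOver q Q
    Module.FaithfullyFlat (Localization.AtPrime q) (Localization.AtPrime Q) :=
  StandardEtaleLocal.faithfullyFlat_atPrime q Q

/-! ## §2 ★★ The stalk clause of a hypersurface germ under finite separable base change -/

/-- The merged clause of `FullCl` is `CMCl ∧ FCl`. [plumbing] -/
theorem cmCl_and_fCl_iff (p : ℕ) (A : Type) [CommRing A] :
    (CMCl A ∧ FCl p A) ↔
      ∀ d : ℕ, ringKrullDim A = d → ∀ s : Fin d → A, (Ideal.span (Set.range s)).radical.IsMaximal →
        RingTheory.Sequence.IsWeaklyRegular A (List.ofFn s) ∧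
        ∀ y : A, (∃ e : ℕ, y ^ p ^ e ∈ Ideal.span ((fun z : A => z ^ p ^ e) '' (Ideal.span (Set.range s) : Set A))) → y ∈ Ideal.span (Set.range s) :=
  ⟨fun h d hd s hs => ⟨h.1 d hd s hs, h.2 d hd s hs⟩, fun h => ⟨fun d hd s hs => (h d hd s hs).1, fun d hd s hs => (h d hd s hs).2⟩⟩

/-- ★★ **THE CRUX'S STALK CLAUSE NEITHER APPEARS NOR DISAPPEARS UNDER FINITE SEPARABLE BASE CHANGE**: `S_q`, `(S ⊗_k K)_Q` regular local (e.g. `S = k[x₁..xₙ]`), `char k = p`,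
`f ∈ 𝔪_q`, `f ≠ 0`, `φ : S_q → (S_K)_Q` the canonical map ⇒ (`CMCl ∧ FCl p` for `S_q/(f)`) ↔ (the same for `(S ⊗_k K)_Q/(φ f)`). Both directions: NOT-FULL descends, FULL ascends and
descends. [OURS · (RF); cite: Fedder1983, Thm. 1.12] -/
theorem clause_hypersurface_iff_separable_baseChange (p : ℕ) [Fact p.Prime] [CharP k p] [Algebra.IsSeparable k K] [FiniteDimensional k K]
    (Q : Ideal (S ⊗[k] K)) [Q.IsPrime] (q : Ideal S) [q.IsPrime] [Q.LiesOver q]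
    [IsRegularLocalRing (Localization.AtPrime q)] [IsRegularLocalRing (Localization.AtPrime Q)]
    (φ : Localization.AtPrime q →+* Localization.AtPrime Q) (hφ : φ = Localization.localRingHom q Q (algebraMap S (S ⊗[k] K)) Ideal.LiesOver.over)
    (f : Localization.AtPrime q) (hfm : f ∈ maximalIdeal (Localization.AtPrime q)) (hf0 : f ≠ 0) :
    (CMCl (Localization.AtPrime q ⧸ Ideal.span {f}) ∧ FCl p (Localization.AtPrime q ⧸ Ideal.span {f})) ↔
      (CMCl (Localization.AtPrime Q ⧸ Ideal.span {φ f}) ∧ FCl p (Localization.AtPrime Q ⧸ Ideal.span {φ f})) := by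
  letI := Localization.AtPrime.algebraOfLiesOver q Q
  haveI : CharP (Localization.AtPrime q) p := charP_of_injective_algebraMap (algebraMap k (Localization.AtPrime q)).injective p
  haveI : CharP (Localization.AtPrime Q) p := charP_of_injective_algebraMap (algebraMap k (Localization.AtPrime Q)).injective p
  haveI := faithfullyFlat_of_baseChange k K S Q q
  subst hφ
  rw [cmCl_and_fCl_iff, cmCl_and_fCl_iff]
  exact FedderEtaleAscent.clause_hypersurface_iff_of_faithfullyFlat p (map_maximalIdeal_eq_of_separable_baseChange k K S Q q) f hfm hf0

/-- ★ **`FullCl` form** (the two `IsDomain` facts supplied by the consumer — `IsDomain` is not étale-local). [OURS · (RF)] -/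
theorem fullCl_hypersurface_iff_separable_baseChange (p : ℕ) [Fact p.Prime] [CharP k p] [Algebra.IsSeparable k K] [FiniteDimensional k K]
    (Q : Ideal (S ⊗[k] K)) [Q.IsPrime] (q : Ideal S) [q.IsPrime] [Q.LiesOver q]
    [IsRegularLocalRing (Localization.AtPrime q)] [IsRegularLocalRing (Localization.AtPrime Q)]
    (φ : Localization.AtPrime q →+* Localization.AtPrime Q) (hφ : φ = Localization.localRingHom q Q (algebraMap S (S ⊗[k] K)) Ideal.LiesOver.over)
    (f : Localization.AtPrime q) (hfm : f ∈ maximalIdeal (Localization.AtPrime q)) (hf0 : f ≠ 0)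
    (hdom : IsDomain (Localization.AtPrime q ⧸ Ideal.span {f})) (hdom' : IsDomain (Localization.AtPrime Q ⧸ Ideal.span {φ f})) :
    FullCl p (Localization.AtPrime q ⧸ Ideal.span {f}) ↔ FullCl p (Localization.AtPrime Q ⧸ Ideal.span {φ f}) := by
  have h := clause_hypersurface_iff_separable_baseChange k K S p Q q φ hφ f hfm hf0
  rw [cmCl_and_fCl_iff, cmCl_and_fCl_iff] at h
  exact ⟨fun hF => ⟨hdom', h.1 hF.2⟩, fun hF => ⟨hdom, h.2 hF.2⟩⟩

end Summit.ResolutionOfSingularities.ResolutionOfSingularities.Theorems.FInjectiveMacaulayfication.SeparableBaseChangeAscent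

end
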